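import Summits.ResolutionOfSingularities.ResolutionOfSingularities.Theorems.FrobeniusLadderFInjectiveMacaulayficationTauFloorF5ChartSymmetry
import Summits.ResolutionOfSingularities.ResolutionOfSingularities.Theorems.FrobeniusLadderFInjectiveMacaulayficationTauFloorF5XChartIdent
import Summits.ResolutionOfSingularities.ResolutionOfSingularities.Theorems.FrobeniusLadderFInjectiveMacaulayficationTauFloorF5ZChart
import Summits.ResolutionOfSingularities.ResolutionOfSingularities.Theorems.FrobeniusLadderFInjectiveMacaulayficationLocalBlowupInputFromCharts
import Summits.ResolutionOfSingularities.ResolutionOfSingularities.Theorems.FrobeniusLadderFInjectiveMacaulayficationTauFloorP2d4F5Row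
import HarnessLib

/-!
# ROW #2 OF THE F(4)-pos LEDGER AS ONE KERNEL THEOREM: the τ-floor of P2d4F5 is a LEGAL input of the F-half, NOT F(4)-iso, and CURED
# (crux `FInjectiveMacaulayfication` stmt-ResolutionOfSingularities-15315, chain w45a; res-L1-w45a-plan-1 R18.32 «(N1) ROW #2 TWO-SIDED → stub-3»;
# seat res-L1-w45a-stub-3 g10; shapes = res-L1-w45a-stub-1's p624171 `TauFloorInputLegal.tauFloor_input_legal` / p624800 `TauFloorInputNotFull.f4pos_row_one`)

[OURS · L1 W4.5a] Support file (`--supports stmt-ResolutionOfSingularities-15315 --as helper`); replaces the role of NO printed item; NOT a statement of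
any manuscript; def-free; UNCONDITIONAL. AI-written (AI review is weaker than expert review).

WHAT. `X = Spec A₀`, `A₀ = k[X0..X4]/(f)`, `f = X4² + X0²X4 + X1⁵ + X2⁵ + X3⁵` (P2d4F5), `char k = 2` (any field), `v` the vertex,
`τ = (x̄, ȳ², ū², t̄², z̄)` (res-L1-w45a-plan-1's τ-centre; res-L1-w45a-stub-2's p627561 spelling), `I := τ̃|_{Spec 𝒪_{X,v}}`. For EVERY blowing up
`g : S′ → Spec 𝒪_{X,v}` along `I`:
* §1–§2 `cmCl_stalk_affineBlowup_tau_over` — `Bl_τ X` satisfies the CM clause at every point OVER `v`: every such stalk is a local ring of one of the Rees charts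
  `D(x̄t), D(ȳ²t), D(ū²t), D(t̄²t)` at a prime over `v` (`D(z̄t)` has none: `TauFloorF5ZChart.map_vertex_eq_top`), and those charts are CM at EVERY prime
  (`TauFloorF5XChartIdent.cmCl_localization_blowupAlgebra`, `TauFloorF5YChartFacts.cmCl_localization_blowupAlgebra`, `TauFloorF5ChartSymmetry`), all by the
  generic flat–integral engine `FlatIntegralCM` (each chart ring is a free finite tower over a polynomial ring in four variables).
* §3 ★★ `tauFloor_P2d4F5_input_legal` — the four `S′`-side binders of `LocalFInjectivizationFibreAdmGe4`: `I ≠ ⊥`; `Supp I ⊆ (Reg)ᶜ`; `S′` regular off the closed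
  fibre; `S′` CM at every point (res-L1-w45a-stub-1's `LocalBlowupInputFromCharts.offFibre_regular_and_cmCl_over`, p627935).
* §4 ★★ `tauFloor_P2d4F5_not_full` — some stalk of `S′` over the closed point is NOT FULL (the generic point of the exceptional divisor on `D(ȳ²)`,
  `TauFloorF5YChartFacts.exists_prime_not_fullCl_blowupAlgebra`, via `TauFloorInputNotFull.exists_point_over_centre_not_fullCl` /
  `exists_not_fullCl_of_isBlowup_comap_fromSpecStalk`).
* §5 ★★★ `f4pos_row_two` — ROW #2 AS ONE KERNEL THEOREM: (legal) ∧ (NOT F(4)-iso) ∧ (cured: res-L1-w45a-stub-2's p627561 `TauFloorP2d4F5Row.tauFloor_P2d4F5_row` over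
  res-L1-w45a-idea-1's `τ·K` certificate).
[folklore assembly; cite: GortzWedhorn2020, (13.19), Prop. 13.91 (2)] [cite: StacksProject, Tag 0804; Tag 02OS; Tag 01J7] [cite: Temkin2008, §2.1]
-/

-- single-problem summit: the doubled namespace component is forced
set_option linter.dupNamespace false

noncomputable section

namespace Summit.ResolutionOfSingularities.ResolutionOfSingularities.Theorems.FInjectiveMacaulayfication.TauFloorP2d4F5RowTwo

open CategoryTheory CategoryTheory.Limits AlgebraicGeometry TopologicalSpace IsLocalRing MvPolynomial
open Literature.AlgebraicGeometry.Resolution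
open Summit.ResolutionOfSingularities.ResolutionOfSingularities.Theorems.FInjectiveMacaulayfication
open SliceableCentre GermOfGlobalBlowup

/-! ## §1 The Rees charts of `Bl_τ X` are CM at every prime over the vertex -/

/-- `x̄0 ≠ 0` in `A₀` (`f(1,0,0,0,0) = 0` is false: `f ∤ X0`). [folklore] -/
theorem mk_X_zero_ne_zero (k : Type) [Field k] (f : MvPolynomial (Fin 5) k) (hf : f = X 4 ^ 2 + X 0 ^ 2 * X 4 + X 1 ^ 5 + X 2 ^ 5 + X 3 ^ 5) : Ideal.Quotient.mk (Ideal.span {f}) (X 0) ≠ 0 := by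
  intro h
  rw [Ideal.Quotient.eq_zero_iff_mem, Ideal.mem_span_singleton] at h
  obtain ⟨c, hc⟩ := h
  have := congrArg (MvPolynomial.eval (Pi.single (0 : Fin 5) (1 : k))) hc
  rw [hf] at this
  simp at this

/-- The generator vector presents `τ`. [plumbing] -/
theorem span_range_eq_tau (k : Type) [Field k] (f : MvPolynomial (Fin 5) k) :
    Ideal.span (Set.range ![Ideal.Quotient.mk (Ideal.span {f}) (X 0), Ideal.Quotient.mk (Ideal.span {f}) (X 1) ^ 2, Ideal.Quotient.mk (Ideal.span {f}) (X 2) ^ 2, Ideal.Quotient.mk (Ideal.span {f}) (X 3) ^ 2, Ideal.Quotient.mk (Ideal.span {f}) (X 4)]) = (Ideal.span {Ideal.Quotient.mk (Ideal.span {f}) (X 0), Ideal.Quotient.mk (Ideal.span {f}) (X 1) ^ 2, Ideal.Quotient.mk (Ideal.span {f}) (X 2) ^ 2, Ideal.Quotient.mk (Ideal.span {f}) (X 3) ^ 2, Ideal.Quotient.mk (Ideal.span {f}) (X 4)} : Ideal (MvPolynomial (Fin 5) k ⧸ Ideal.span {f})) := by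
  simp only [Matrix.range_cons, Matrix.range_empty, Set.union_empty, Set.singleton_union]

set_option maxHeartbeats 800000 in
-- five chart cases, each one transport
/-- The five Rees charts of `Bl_τ X` at `a ∈ {x̄, ȳ², ū², t̄², z̄}` are CM at every prime CONTRACTING TO `v` (for the first four: at every prime; `D(z̄)` has no such
prime). [folklore assembly] -/
theorem cmCl_reesChart_tau_over (k : Type) [Field k] [CharP k 2] (f : MvPolynomial (Fin 5) k) (hf : f = X 4 ^ 2 + X 0 ^ 2 * X 4 + X 1 ^ 5 + X 2 ^ 5 + X 3 ^ 5) (v : Spec (.of (MvPolynomial (Fin 5) k ⧸ Ideal.span {f})))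
    (hv : v.asIdeal = Ideal.span (Set.range fun j : Fin 5 => Ideal.Quotient.mk (Ideal.span {f}) (X j)))
    (a : MvPolynomial (Fin 5) k ⧸ Ideal.span {f}) (ha : a ∈ (Ideal.span {Ideal.Quotient.mk (Ideal.span {f}) (X 0), Ideal.Quotient.mk (Ideal.span {f}) (X 1) ^ 2, Ideal.Quotient.mk (Ideal.span {f}) (X 2) ^ 2, Ideal.Quotient.mk (Ideal.span {f}) (X 3) ^ 2, Ideal.Quotient.mk (Ideal.span {f}) (X 4)} : Ideal (MvPolynomial (Fin 5) k ⧸ Ideal.span {f})))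
    (h : a = Ideal.Quotient.mk (Ideal.span {f}) (X 0) ∨ a = Ideal.Quotient.mk (Ideal.span {f}) (X 1) ^ 2 ∨ a = Ideal.Quotient.mk (Ideal.span {f}) (X 2) ^ 2 ∨ a = Ideal.Quotient.mk (Ideal.span {f}) (X 3) ^ 2 ∨ a = Ideal.Quotient.mk (Ideal.span {f}) (X 4))
    (q : PrimeSpectrum (HomogeneousLocalization.Away (reesGrading (Ideal.span {Ideal.Quotient.mk (Ideal.span {f}) (X 0), Ideal.Quotient.mk (Ideal.span {f}) (X 1) ^ 2, Ideal.Quotient.mk (Ideal.span {f}) (X 2) ^ 2, Ideal.Quotient.mk (Ideal.span {f}) (X 3) ^ 2, Ideal.Quotient.mk (Ideal.span {f}) (X 4)} : Ideal (MvPolynomial (Fin 5) k ⧸ Ideal.span {f}))) (reesT a ha)))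
    (hq : PrimeSpectrum.comap (reesChartBase a ha) q = v) : CMCl (Localization.AtPrime q.asIdeal) := by
  rcases h with rfl | rfl | rfl | rfl | rfl
  · exact ReesChartFacts.reesChart_cmCl_of_blowupAlgebra_cmCl _ _ ha (fun Q _ => TauFloorF5XChartIdent.cmCl_localization_blowupAlgebra k f hf Q) q.asIdeal
  · exact ReesChartFacts.reesChart_cmCl_of_blowupAlgebra_cmCl _ _ ha (fun Q _ => TauFloorF5YChartFacts.cmCl_localization_blowupAlgebra k f hf Q) q.asIdeal
  · exact ReesChartFacts.reesChart_cmCl_of_blowupAlgebra_cmCl _ _ ha (fun Q _ => TauFloorF5ChartSymmetry.cmCl_localization_blowupAlgebra_of_swap k f hf 2 (Or.inl rfl) Q) q.asIdeal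
  · exact ReesChartFacts.reesChart_cmCl_of_blowupAlgebra_cmCl _ _ ha (fun Q _ => TauFloorF5ChartSymmetry.cmCl_localization_blowupAlgebra_of_swap k f hf 3 (Or.inr rfl) Q) q.asIdeal
  · exact absurd hq (LocalBlowupInputFromCharts.not_comap_eq_of_map_eq_top _ _ ha v (TauFloorF5ZChart.map_vertex_eq_top k f hf v hv) q)

/-! ## §2 `Bl_τ X` is CM at every point over `v` -/

set_option maxHeartbeats 800000 in
-- the `Set.range`-presentation transport of `TauFloorInputLegal.cmCl_stalk_affineBlowup_tau`
/-- ★ **`Bl_τ X = affineBlowup τ` satisfies the CM clause at every point over the vertex.** [folklore assembly; cite: StacksProject, Tag 0804] -/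
theorem cmCl_stalk_affineBlowup_tau_over (k : Type) [Field k] [CharP k 2] (f : MvPolynomial (Fin 5) k) (hf : f = X 4 ^ 2 + X 0 ^ 2 * X 4 + X 1 ^ 5 + X 2 ^ 5 + X 3 ^ 5) (v : Spec (.of (MvPolynomial (Fin 5) k ⧸ Ideal.span {f})))
    (hv : v.asIdeal = Ideal.span (Set.range fun j : Fin 5 => Ideal.Quotient.mk (Ideal.span {f}) (X j)))
    (y : ↥(affineBlowup (Ideal.span {Ideal.Quotient.mk (Ideal.span {f}) (X 0), Ideal.Quotient.mk (Ideal.span {f}) (X 1) ^ 2, Ideal.Quotient.mk (Ideal.span {f}) (X 2) ^ 2, Ideal.Quotient.mk (Ideal.span {f}) (X 3) ^ 2, Ideal.Quotient.mk (Ideal.span {f}) (X 4)} : Ideal (MvPolynomial (Fin 5) k ⧸ Ideal.span {f})))) (hy : (affineBlowup.π (Ideal.span {Ideal.Quotient.mk (Ideal.span {f}) (X 0), Ideal.Quotient.mk (Ideal.span {f}) (X 1) ^ 2, Ideal.Quotient.mk (Ideal.span {f}) (X 2) ^ 2, Ideal.Quotient.mk (Ideal.span {f}) (X 3) ^ 2,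 Ideal.Quotient.mk (Ideal.span {f}) (X 4)} : Ideal (MvPolynomial (Fin 5) k ⧸ Ideal.span {f}))).base y = v) :
    CMCl ((affineBlowup (Ideal.span {Ideal.Quotient.mk (Ideal.span {f}) (X 0), Ideal.Quotient.mk (Ideal.span {f}) (X 1) ^ 2, Ideal.Quotient.mk (Ideal.span {f}) (X 2) ^ 2, Ideal.Quotient.mk (Ideal.span {f}) (X 3) ^ 2, Ideal.Quotient.mk (Ideal.span {f}) (X 4)} : Ideal (MvPolynomial (Fin 5) k ⧸ Ideal.span {f}))).presheaf.stalk y) := by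
  have key : ∀ (J : Ideal (MvPolynomial (Fin 5) k ⧸ Ideal.span {f})), J = (Ideal.span {Ideal.Quotient.mk (Ideal.span {f}) (X 0), Ideal.Quotient.mk (Ideal.span {f}) (X 1) ^ 2, Ideal.Quotient.mk (Ideal.span {f}) (X 2) ^ 2, Ideal.Quotient.mk (Ideal.span {f}) (X 3) ^ 2, Ideal.Quotient.mk (Ideal.span {f}) (X 4)} : Ideal (MvPolynomial (Fin 5) k ⧸ Ideal.span {f})) →
      ∀ (i : Fin 5) (hi : (![Ideal.Quotient.mk (Ideal.span {f}) (X 0), Ideal.Quotient.mk (Ideal.span {f}) (X 1) ^ 2, Ideal.Quotient.mk (Ideal.span {f}) (X 2) ^ 2, Ideal.Quotient.mk (Ideal.span {f}) (X 3) ^ 2, Ideal.Quotient.mk (Ideal.span {f}) (X 4)] : Fin 5 → MvPolynomial (Fin 5) k ⧸ Ideal.span {f}) i ∈ J)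
        (q : PrimeSpectrum (HomogeneousLocalization.Away (reesGrading J) (reesT _ hi))), PrimeSpectrum.comap (reesChartBase _ hi) q = v →
        CMCl (Localization.AtPrime q.asIdeal) := by
    rintro J rfl i hi q hq
    refine cmCl_reesChart_tau_over k f hf v hv _ hi ?_ q hq
    fin_cases i
    exacts [Or.inl rfl, Or.inr (Or.inl rfl), Or.inr (Or.inr (Or.inl rfl)), Or.inr (Or.inr (Or.inr (Or.inl rfl))), Or.inr (Or.inr (Or.inr (Or.inr rfl)))]
  have h := LocalBlowupInputFromCharts.cmCl_stalk_affineBlowup_of_charts_over (![Ideal.Quotient.mk (Ideal.span {f}) (X 0), Ideal.Quotient.mk (Ideal.span {f}) (X 1) ^ 2, Ideal.Quotient.mk (Ideal.span {f}) (X 2) ^ 2, Ideal.Quotient.mk (Ideal.span {f}) (X 3) ^ 2, Ideal.Quotient.mk (Ideal.span {f}) (X 4)] : Fin 5 → MvPolynomial (Fin 5) k ⧸ Ideal.span {f}) v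
    (fun i _ q hq => key _ (span_range_eq_tau k f) i _ q hq)
  rw [span_range_eq_tau k f] at h
  exact h y hy

/-! ## §3 The τ-floor is a legal input of the F-half -/

/-- The support `V(τ)` of `τ̃` meets the generizations of `v` only in `v`. [plumbing] -/
theorem support_tau_specializes (k : Type) [Field k] (f : MvPolynomial (Fin 5) k) (v : Spec (.of (MvPolynomial (Fin 5) k ⧸ Ideal.span {f})))
    (hv : v.asIdeal = Ideal.span (Set.range fun j : Fin 5 => Ideal.Quotient.mk (Ideal.span {f}) (X j))) :
    ∀ y ∈ ((affineBlowup.idealSheaf (Ideal.span {Ideal.Quotient.mk (Ideal.span {f}) (X 0), Ideal.Quotient.mk (Ideal.span {f}) (X 1) ^ 2, Ideal.Quotient.mk (Ideal.span {f}) (X 2) ^ 2, Ideal.Quotient.mk (Ideal.span {f}) (X 3) ^ 2, Ideal.Quotient.mk (Ideal.span {f}) (X 4)} : Ideal (MvPolynomial (Fin 5) k ⧸ Ideal.span {f}))).support : Set (Spec (.of (MvPolynomial (Fin 5) k ⧸ Ideal.span {f})))), y ⤳ v → y = v := by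
  intro y hy hyv
  rw [affineBlowup.support_idealSheaf] at hy
  have hτy : (Ideal.span {Ideal.Quotient.mk (Ideal.span {f}) (X 0), Ideal.Quotient.mk (Ideal.span {f}) (X 1) ^ 2, Ideal.Quotient.mk (Ideal.span {f}) (X 2) ^ 2, Ideal.Quotient.mk (Ideal.span {f}) (X 3) ^ 2, Ideal.Quotient.mk (Ideal.span {f}) (X 4)} : Ideal (MvPolynomial (Fin 5) k ⧸ Ideal.span {f})) ≤ y.asIdeal := fun a ha => hy ha
  have h1 : v.asIdeal ≤ y.asIdeal := by
    rw [hv, Ideal.span_le]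
    rintro _ ⟨j, rfl⟩
    fin_cases j
    · exact hτy (Ideal.subset_span (by simp))
    · exact y.2.mem_of_pow_mem 2 (hτy (Ideal.subset_span (by simp)))
    · exact y.2.mem_of_pow_mem 2 (hτy (Ideal.subset_span (by simp)))
    · exact y.2.mem_of_pow_mem 2 (hτy (Ideal.subset_span (by simp)))
    · exact hτy (Ideal.subset_span (by simp))
  have h2 : y.asIdeal ≤ v.asIdeal := (PrimeSpectrum.le_iff_specializes y v).mpr hyv
  exact PrimeSpectrum.ext (le_antisymm h2 h1)

/-- ★★ **F4POS ROW #2 (d): THE τ-FLOOR OF P2d4F5 IS A LEGAL INPUT OF THE F-HALF.** For every blowing up `g : S′ → Spec 𝒪_{X,v}` along `I = τ̃|_{Spec 𝒪_{X,v}}`: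
(1) `I ≠ ⊥`; (2) `Supp I ⊆ (Reg Spec 𝒪_{X,v})ᶜ`; (3) `S′` is regular off the closed fibre; (4) `S′` satisfies the CM clause at every point.
[folklore assembly; cite: GortzWedhorn2020, Prop. 13.91 (2), (13.19)] [cite: StacksProject, Tag 02OS; Tag 01J7] [cite: Temkin2008, §2.1] -/
theorem tauFloor_P2d4F5_input_legal (k : Type) [Field k] [CharP k 2] (f : MvPolynomial (Fin 5) k) (hf : f = X 4 ^ 2 + X 0 ^ 2 * X 4 + X 1 ^ 5 + X 2 ^ 5 + X 3 ^ 5)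
    (v : Spec (.of (MvPolynomial (Fin 5) k ⧸ Ideal.span {f})))
    (hv : v.asIdeal = Ideal.span (Set.range fun j : Fin 5 => Ideal.Quotient.mk (Ideal.span {f}) (X j)))
    (S' : Scheme.{0}) (g : S' ⟶ Spec ((Spec (.of (MvPolynomial (Fin 5) k ⧸ Ideal.span {f}))).presheaf.stalk v))
    (hg : IsBlowup g ((affineBlowup.idealSheaf
        (Ideal.span {Ideal.Quotient.mk (Ideal.span {f}) (X 0), Ideal.Quotient.mk (Ideal.span {f}) (X 1) ^ 2, Ideal.Quotient.mk (Ideal.span {f}) (X 2) ^ 2, Ideal.Quotient.mk (Ideal.span {f}) (X 3) ^ 2, Ideal.Quotient.mk (Ideal.span {f}) (X 4)})).comap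
        ((Spec (.of (MvPolynomial (Fin 5) k ⧸ Ideal.span {f}))).fromSpecStalk v))) :
    ((affineBlowup.idealSheaf
        (Ideal.span {Ideal.Quotient.mk (Ideal.span {f}) (X 0), Ideal.Quotient.mk (Ideal.span {f}) (X 1) ^ 2, Ideal.Quotient.mk (Ideal.span {f}) (X 2) ^ 2, Ideal.Quotient.mk (Ideal.span {f}) (X 3) ^ 2, Ideal.Quotient.mk (Ideal.span {f}) (X 4)})).comap
        ((Spec (.of (MvPolynomial (Fin 5) k ⧸ Ideal.span {f}))).fromSpecStalk v)) ≠ ⊥ ∧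
    (((((affineBlowup.idealSheaf
        (Ideal.span {Ideal.Quotient.mk (Ideal.span {f}) (X 0), Ideal.Quotient.mk (Ideal.span {f}) (X 1) ^ 2, Ideal.Quotient.mk (Ideal.span {f}) (X 2) ^ 2, Ideal.Quotient.mk (Ideal.span {f}) (X 3) ^ 2, Ideal.Quotient.mk (Ideal.span {f}) (X 4)})).comap
        ((Spec (.of (MvPolynomial (Fin 5) k ⧸ Ideal.span {f}))).fromSpecStalk v))).support : Set (Spec ((Spec (.of (MvPolynomial (Fin 5) k ⧸ Ideal.span {f}))).presheaf.stalk v))) ⊆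
      (Scheme.regularLocus (Spec ((Spec (.of (MvPolynomial (Fin 5) k ⧸ Ideal.span {f}))).presheaf.stalk v)))ᶜ) ∧
    (∀ s : S', g.base s ≠ closedPoint ((Spec (.of (MvPolynomial (Fin 5) k ⧸ Ideal.span {f}))).presheaf.stalk v) → s ∈ Scheme.regularLocus S') ∧
    (∀ s : S', CMCl (S'.presheaf.stalk s)) := by
  classical
  haveI := P2d4F5Specimen.isIntegral_p2d4f5 k f hf
  have hτ0 : (Ideal.span {Ideal.Quotient.mk (Ideal.span {f}) (X 0), Ideal.Quotient.mk (Ideal.span {f}) (X 1) ^ 2, Ideal.Quotient.mk (Ideal.span {f}) (X 2) ^ 2, Ideal.Quotient.mk (Ideal.span {f}) (X 3) ^ 2, Ideal.Quotient.mk (Ideal.span {f}) (X 4)} : Ideal (MvPolynomial (Fin 5) k ⧸ Ideal.span {f})) ≠ ⊥ := by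
    intro h0
    have hmem : Ideal.Quotient.mk (Ideal.span {f}) (X 0) ∈ (Ideal.span {Ideal.Quotient.mk (Ideal.span {f}) (X 0), Ideal.Quotient.mk (Ideal.span {f}) (X 1) ^ 2, Ideal.Quotient.mk (Ideal.span {f}) (X 2) ^ 2, Ideal.Quotient.mk (Ideal.span {f}) (X 3) ^ 2, Ideal.Quotient.mk (Ideal.span {f}) (X 4)} : Ideal (MvPolynomial (Fin 5) k ⧸ Ideal.span {f})) := Ideal.subset_span (by simp)
    rw [h0, Ideal.mem_bot] at hmem
    exact mk_X_zero_ne_zero k f hf hmem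
  have hsupp := support_tau_specializes k f v hv
  have h34 := LocalBlowupInputFromCharts.offFibre_regular_and_cmCl_over v (affineBlowup.isBlowup _) hsupp (P2d4F5Specimen.regular_of_ne_vertex k f hf v hv)
    (cmCl_stalk_affineBlowup_tau_over k f hf v hv) hg
  exact ⟨comap_fromSpecStalk_ne_bot (affineBlowup.idealSheaf_ne_bot hτ0) v,
    TauFloorInputLegal.support_comap_subset_compl_regularLocus v _ hsupp (P2d4F5Specimen.vertex_not_mem_regularLocus k f hf v hv), h34.1, h34.2⟩

/-! ## §4 The τ-floor is NOT F(4)-iso -/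

/-- ★ **A point of `Bl_τ X` over the vertex with a NON-FULL stalk** (from the chart `D(ȳ²)`: `TauFloorF5YChartFacts.exists_prime_not_fullCl_blowupAlgebra`).
[OURS · assembly of landed chart facts] -/
theorem exists_point_over_vertex_not_fullCl (k : Type) [Field k] (f : MvPolynomial (Fin 5) k) (hf : f = X 4 ^ 2 + X 0 ^ 2 * X 4 + X 1 ^ 5 + X 2 ^ 5 + X 3 ^ 5)
    (v : Spec (.of (MvPolynomial (Fin 5) k ⧸ Ideal.span {f})))
    (hv : v.asIdeal = Ideal.span (Set.range fun j : Fin 5 => Ideal.Quotient.mk (Ideal.span {f}) (X j))) :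
    ∃ b : ↥(affineBlowup (Ideal.span {Ideal.Quotient.mk (Ideal.span {f}) (X 0), Ideal.Quotient.mk (Ideal.span {f}) (X 1) ^ 2, Ideal.Quotient.mk (Ideal.span {f}) (X 2) ^ 2, Ideal.Quotient.mk (Ideal.span {f}) (X 3) ^ 2, Ideal.Quotient.mk (Ideal.span {f}) (X 4)} : Ideal (MvPolynomial (Fin 5) k ⧸ Ideal.span {f}))),
      (affineBlowup.π _).base b = v ∧ ¬ FullCl 2 ((affineBlowup (Ideal.span {Ideal.Quotient.mk (Ideal.span {f}) (X 0), Ideal.Quotient.mk (Ideal.span {f}) (X 1) ^ 2, Ideal.Quotient.mk (Ideal.span {f}) (X 2) ^ 2, Ideal.Quotient.mk (Ideal.span {f}) (X 3) ^ 2, Ideal.Quotient.mk (Ideal.span {f}) (X 4)} : Ideal (MvPolynomial (Fin 5) k ⧸ Ideal.span {f}))).presheaf.stalk b) := by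
  classical
  obtain ⟨Q, hQ, hyQ, hbad⟩ := TauFloorF5YChartFacts.exists_prime_not_fullCl_blowupAlgebra k f hf
  have hy : Ideal.Quotient.mk (Ideal.span {f}) (X 1) ^ 2 ∈ (Ideal.span {Ideal.Quotient.mk (Ideal.span {f}) (X 0), Ideal.Quotient.mk (Ideal.span {f}) (X 1) ^ 2, Ideal.Quotient.mk (Ideal.span {f}) (X 2) ^ 2, Ideal.Quotient.mk (Ideal.span {f}) (X 3) ^ 2, Ideal.Quotient.mk (Ideal.span {f}) (X 4)} : Ideal (MvPolynomial (Fin 5) k ⧸ Ideal.span {f})) := Ideal.subset_span (by simp)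
  obtain ⟨b, hb, hbadb⟩ := TauFloorInputNotFull.exists_point_over_centre_not_fullCl _ _ hy 2 Q hyQ hbad
  refine ⟨b, ?_, hbadb⟩
  haveI hmax : v.asIdeal.IsMaximal := by
    rw [hv]; exact DoublePointFermatCubicGerm.isMaximal_origin k f (P2d4F5Specimen.constantCoeff_f k f hf)
  have h1 : v.asIdeal ≤ ((affineBlowup.π _).base b).asIdeal := by
    rw [hv, Ideal.span_le]
    rintro _ ⟨j, rfl⟩
    fin_cases j
    · exact hb (Ideal.subset_span (by simp))
    · exact ((affineBlowup.π _).base b).2.mem_of_pow_mem 2 (hb (Ideal.subset_span (by simp)))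
    · exact ((affineBlowup.π _).base b).2.mem_of_pow_mem 2 (hb (Ideal.subset_span (by simp)))
    · exact ((affineBlowup.π _).base b).2.mem_of_pow_mem 2 (hb (Ideal.subset_span (by simp)))
    · exact hb (Ideal.subset_span (by simp))
  exact (PrimeSpectrum.ext (hmax.eq_of_le ((affineBlowup.π _).base b).2.ne_top h1)).symm

/-- ★★ **F4POS ROW #2 (e): THE τ-FLOOR OF P2d4F5 IS NOT AN F(4)-iso INPUT.** For every blowing up `g : S′ → Spec 𝒪_{X,v}` along `I` there is a point `s ∈ S′` over the
closed point whose local ring is NOT FULL. [OURS · assembly; cite: GortzWedhorn2020, Prop. 13.91 (2)] [cite: Temkin2008, §2.1] -/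
theorem tauFloor_P2d4F5_not_full (k : Type) [Field k] (f : MvPolynomial (Fin 5) k) (hf : f = X 4 ^ 2 + X 0 ^ 2 * X 4 + X 1 ^ 5 + X 2 ^ 5 + X 3 ^ 5)
    (v : Spec (.of (MvPolynomial (Fin 5) k ⧸ Ideal.span {f})))
    (hv : v.asIdeal = Ideal.span (Set.range fun j : Fin 5 => Ideal.Quotient.mk (Ideal.span {f}) (X j)))
    (S' : Scheme.{0}) (g : S' ⟶ Spec ((Spec (.of (MvPolynomial (Fin 5) k ⧸ Ideal.span {f}))).presheaf.stalk v))
    (hg : IsBlowup g ((affineBlowup.idealSheaf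
        (Ideal.span {Ideal.Quotient.mk (Ideal.span {f}) (X 0), Ideal.Quotient.mk (Ideal.span {f}) (X 1) ^ 2, Ideal.Quotient.mk (Ideal.span {f}) (X 2) ^ 2, Ideal.Quotient.mk (Ideal.span {f}) (X 3) ^ 2, Ideal.Quotient.mk (Ideal.span {f}) (X 4)})).comap
        ((Spec (.of (MvPolynomial (Fin 5) k ⧸ Ideal.span {f}))).fromSpecStalk v))) :
    ∃ s : S', g.base s = closedPoint ((Spec (.of (MvPolynomial (Fin 5) k ⧸ Ideal.span {f}))).presheaf.stalk v) ∧ ¬ FullCl 2 (S'.presheaf.stalk s) :=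
  TauFloorInputNotFull.exists_not_fullCl_of_isBlowup_comap_fromSpecStalk 2 v (affineBlowup.isBlowup _) (exists_point_over_vertex_not_fullCl k f hf v hv) hg

/-! ## §5 Row #2 of the F(4)-pos ledger as one theorem -/

/-- ★★★ **ROW #2 (P2d4F5 τ-floor; char 2, any field) AS ONE KERNEL THEOREM: LEGAL ∧ NOT F(4)-iso ∧ CURED.** For every blowing up `g : S′ → Spec 𝒪_{X,v}` along
`I = τ̃|_{Spec 𝒪_{X,v}}`: (legal, §3) `I ≠ ⊥`, `Supp I ⊆ (Reg)ᶜ`, `S′` regular off the closed fibre and CM everywhere; (NOT F(4)-iso, §4) some stalk of `S′` over the closed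
point is NOT FULL; (cured, res-L1-w45a-stub-2's p627561 over res-L1-w45a-idea-1's `τ·K` certificate) there is `𝓚 ≠ ⊥` on `S′`, supported over the closed point, ALL of
whose blowings up are FULL at every stalk. [OURS · assembly of landed theorems] -/
theorem f4pos_row_two (k : Type) [Field k] [CharP k 2] (f : MvPolynomial (Fin 5) k) (hf : f = X 4 ^ 2 + X 0 ^ 2 * X 4 + X 1 ^ 5 + X 2 ^ 5 + X 3 ^ 5)
    (v : Spec (.of (MvPolynomial (Fin 5) k ⧸ Ideal.span {f})))
    (hv : v.asIdeal = Ideal.span (Set.range fun j : Fin 5 => Ideal.Quotient.mk (Ideal.span {f}) (X j)))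
    (S' : Scheme.{0}) (g : S' ⟶ Spec ((Spec (.of (MvPolynomial (Fin 5) k ⧸ Ideal.span {f}))).presheaf.stalk v))
    (hg : IsBlowup g ((affineBlowup.idealSheaf
        (Ideal.span {Ideal.Quotient.mk (Ideal.span {f}) (X 0), Ideal.Quotient.mk (Ideal.span {f}) (X 1) ^ 2, Ideal.Quotient.mk (Ideal.span {f}) (X 2) ^ 2, Ideal.Quotient.mk (Ideal.span {f}) (X 3) ^ 2, Ideal.Quotient.mk (Ideal.span {f}) (X 4)})).comap
        ((Spec (.of (MvPolynomial (Fin 5) k ⧸ Ideal.span {f}))).fromSpecStalk v))) :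
    (((affineBlowup.idealSheaf
        (Ideal.span {Ideal.Quotient.mk (Ideal.span {f}) (X 0), Ideal.Quotient.mk (Ideal.span {f}) (X 1) ^ 2, Ideal.Quotient.mk (Ideal.span {f}) (X 2) ^ 2, Ideal.Quotient.mk (Ideal.span {f}) (X 3) ^ 2, Ideal.Quotient.mk (Ideal.span {f}) (X 4)})).comap
        ((Spec (.of (MvPolynomial (Fin 5) k ⧸ Ideal.span {f}))).fromSpecStalk v)) ≠ ⊥ ∧
    (((((affineBlowup.idealSheaf
        (Ideal.span {Ideal.Quotient.mk (Ideal.span {f}) (X 0), Ideal.Quotient.mk (Ideal.span {f}) (X 1) ^ 2, Ideal.Quotient.mk (Ideal.span {f}) (X 2) ^ 2, Ideal.Quotient.mk (Ideal.span {f}) (X 3) ^ 2, Ideal.Quotient.mk (Ideal.span {f}) (X 4)})).comap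
        ((Spec (.of (MvPolynomial (Fin 5) k ⧸ Ideal.span {f}))).fromSpecStalk v))).support : Set (Spec ((Spec (.of (MvPolynomial (Fin 5) k ⧸ Ideal.span {f}))).presheaf.stalk v))) ⊆
      (Scheme.regularLocus (Spec ((Spec (.of (MvPolynomial (Fin 5) k ⧸ Ideal.span {f}))).presheaf.stalk v)))ᶜ) ∧
    (∀ s : S', g.base s ≠ closedPoint ((Spec (.of (MvPolynomial (Fin 5) k ⧸ Ideal.span {f}))).presheaf.stalk v) → s ∈ Scheme.regularLocus S') ∧
    (∀ s : S', CMCl (S'.presheaf.stalk s))) ∧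
    (∃ s : S', g.base s = closedPoint ((Spec (.of (MvPolynomial (Fin 5) k ⧸ Ideal.span {f}))).presheaf.stalk v) ∧ ¬ FullCl 2 (S'.presheaf.stalk s)) ∧
    (∃ 𝓚 : S'.IdealSheafData, 𝓚 ≠ ⊥ ∧
      (∀ s ∈ (𝓚.support : Set S'), g.base s = closedPoint ((Spec (.of (MvPolynomial (Fin 5) k ⧸ Ideal.span {f}))).presheaf.stalk v)) ∧
      ∀ (S'' : Scheme.{0}) (π : S'' ⟶ S'), IsBlowup π 𝓚 → ∀ s : S'', FullCl 2 (S''.presheaf.stalk s)) :=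
  ⟨tauFloor_P2d4F5_input_legal k f hf v hv S' g hg, tauFloor_P2d4F5_not_full k f hf v hv S' g hg,
    TauFloorP2d4F5Row.tauFloor_P2d4F5_row k f hf v hv S' g hg⟩

end Summit.ResolutionOfSingularities.ResolutionOfSingularities.Theorems.FInjectiveMacaulayfication.TauFloorP2d4F5RowTwo

end
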